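import Mathlib
import HarnessLib
import Summits.HubbardSuperconductivity.HubbardSuperconductivity.Theorems.KLProgrammeKLRegimeEnginePairLadderApriori
import Summits.HubbardSuperconductivity.HubbardSuperconductivity.Theorems.KLProgrammeKLRegimeEngineLadderIncrement

/-!
# Route `KLProgramme` — ENGINE child gen 8 (stmt-HubbardSuperconductivity-20437 `KLRegimeEngineV17F2`), skeleton v2 class #5 «(S)-transfer» rev 3: the A PRIORI size
# of a Riccati flow from its start size, rate and (bootstrapped) source — `kltc_riccati_rate_le`, `kltc_apriori_riccati`
# (cell gate-hubbard-kl, seat hubbard-kl-k3c1-p1 g11, technique «composed-map remainder propagation»)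

WHY.  The SIZES bundle of `pairTransferRelAt_succ_keyed` (p592121) asks for an a priori bound `|Aᵢ(t)| ≤ m` of each member array along the slice.  With the flow in
Riccati form `Ȧ = −A·diag ḃ·A + S` (`klmf_riccati_of_defect`), the rate row `Σ_c‖ḃ_c‖ ≤ β′` (`klmf_sum_norm_rate_le`: `β′ = 2^10·15367`), a start size `|A(0)| ≤ m₀`
(history a priori + the (F)(i) start shift) and a source bound `|S(t)| ≤ ξ` that may itself be proved UNDER the bootstrap assumption `|A(t)| ≤ m`, the within-slice
bootstrap `kltc_apriori_matrix_of_flow` (p507321) gives `|A(t)| ≤ m` as soon as `m₀ + m²β′ + ξ < m`: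
* `kltc_riccati_rate_le`: under `|A| ≤ m`, `‖(−A·diag ḃ·A + S)(x,y)‖ ≤ m²·Σ_c‖ḃ_c‖ + ‖S(x,y)‖`;
* **`kltc_apriori_riccati`**: the packaged bootstrap.
Real analysis over landed lemmas; nothing about the model's sizes is asserted; nothing asserts superconductivity.  0 kit.
-/

noncomputable section

namespace Summit.HubbardSuperconductivity.HubbardSuperconductivity.Theorems.KLRegimeSplit

set_option linter.dupNamespace false -- summit = problem name (single-conjunct summit), D-0017

open Finset Matrix Set

section Apriori

variable {ι : Type*} [Fintype ι] [DecidableEq ι]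

/-- **Rate of a Riccati flow under the a priori size**: `|A| ≤ m` ⇒ `‖(−(A·diag ḃ·A) + S)(x,y)‖ ≤ m²·Σ_c‖ḃ_c‖ + ‖S(x,y)‖`. -/
theorem kltc_riccati_rate_le (A S : Matrix ι ι ℂ) (b' : ι → ℂ) {m : ℝ} (hm : 0 ≤ m) (hA : ∀ x y, ‖A x y‖ ≤ m) (x y : ι) :
    ‖(-(A * diagonal b' * A) + S) x y‖ ≤ m * m * ∑ c, ‖b' c‖ + ‖S x y‖ := by
  rw [Matrix.add_apply, Matrix.neg_apply]
  refine (norm_add_le _ _).trans (add_le_add ?_ le_rfl)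
  rw [norm_neg, klli_mul_diag_mul_apply, Finset.mul_sum]
  refine (norm_sum_le _ _).trans (sum_le_sum fun c _ => ?_)
  rw [norm_mul, norm_mul]
  calc ‖A x c‖ * ‖b' c‖ * ‖A c y‖ ≤ m * ‖b' c‖ * m :=
        mul_le_mul (mul_le_mul_of_nonneg_right (hA x c) (norm_nonneg _)) (hA c y) (norm_nonneg _) (mul_nonneg hm (norm_nonneg _))
    _ = m * m * ‖b' c‖ := by ring

/-- **A priori size of a Riccati flow on `[0,1]` (bootstrap)**: start size `m₀`, rate `β′`, a source bound `ξ` valid under the bootstrap assumption, and the slack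
`m₀ + m²β′ + ξ < m` give `|A(t)| ≤ m` along the whole slice. -/
theorem kltc_apriori_riccati (A A' S : ℝ → Matrix ι ι ℂ) (b' : ℝ → ι → ℂ) {m m₀ β' ξ : ℝ} (hm : 0 ≤ m) (hm₀ : 0 ≤ m₀) (hβ' : 0 ≤ β') (hξ : 0 ≤ ξ)
    (hA : ∀ t ∈ Icc (0 : ℝ) 1, ∀ x y, HasDerivAt (fun s => A s x y) (A' t x y) t)
    (hflow : ∀ t ∈ Icc (0 : ℝ) 1, A' t = -(A t * diagonal (b' t) * A t) + S t)
    (h0 : ∀ x y, ‖A 0 x y‖ ≤ m₀) (hrate : ∀ t ∈ Icc (0 : ℝ) 1, ∑ c, ‖b' t c‖ ≤ β')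
    (hS : ∀ t ∈ Ico (0 : ℝ) 1, (∀ x y, ‖A t x y‖ ≤ m) → ∀ x y, ‖S t x y‖ ≤ ξ)
    (hslack : m₀ + (m * m * β' + ξ) < m) :
    ∀ t ∈ Icc (0 : ℝ) 1, ∀ x y, ‖A t x y‖ ≤ m := by
  refine kltc_apriori_matrix_of_flow A A' (fun _ => m * m * β' + ξ) hm₀ hA continuousOn_const (fun t _ => by positivity) h0
    (fun t ht hb x y => ?_) (by rw [intervalIntegral.integral_const]; simpa using hslack)
  have ht' : t ∈ Icc (0 : ℝ) 1 := ⟨ht.1, ht.2.le⟩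
  rw [hflow t ht']
  refine (kltc_riccati_rate_le (A t) (S t) (b' t) hm hb x y).trans ?_
  have h1 := hrate t ht'
  have h2 := hS t ht hb x y
  have hmm : 0 ≤ m * m := mul_nonneg hm hm
  nlinarith

end Apriori

end Summit.HubbardSuperconductivity.HubbardSuperconductivity.Theorems.KLRegimeSplit

end
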